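import Summits.BirchSwinnertonDyer.BirchSwinnertonDyer.Theorems.ByReductionTypeAtTwoMultTransportTwistedDescentCohTwoTools
import Summits.BirchSwinnertonDyer.BirchSwinnertonDyer.Theorems.ByReductionTypeAtTwoMultTransportTwistedDescentTateLine
import Literature.NumberTheory.EllipticCurves.ZpExtensionGaloisTwistLevel
import Literature.NumberTheory.GaloisRepresentations.ContinuousCohomologyConnectingNaturality
import Literature.NumberTheory.GaloisRepresentations.ContinuousCohomologyNineTerm
import Literature.NumberTheory.GaloisRepresentations.PPrimaryDevissage
import Literature.NumberTheory.GaloisRepresentations.LocalFieldCdTwo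
import Literature.NumberTheory.Automorphic.AdicCompletionLocalField
import HarnessLib

/-!
# T-42-mult in the kernel, XXXIX: lifting an extended quotient class to the twisted module at a
# higher level (`H¹(Γ_{ℚ_v}, E[2^J]/C_J (χ_u)) → H¹(Γ_{ℚ_v}, E[2^{J'}](χ_u))`, `J' ≥ J`)

Cell `bsd-2adic` (run/shared/lean/pub/bsd-2adic/), seat `bsd-2adic-t42` (BRIEF-T42), GEN 17. HONEST FRAMING:
research route; THEOREMS ONLY (no `def`, no named fact, no instance); nothing booked; nothing re-keyed
(RC-169); BSD is not proved by any of this. PARTITION: X5@2 multiplicative GV-transport rows (K4ᵐ O1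
`MultCongruenceTransportAtTwo`; the residual `T2` of `hF3b_of_prop49_T2`, file XXX) × p = 2 — types-the-object-of;
bears_on K4 items 19922 / 19923 (`--supports stmt-BirchSwinnertonDyer-19923`). Brick (e) of
HOME/t42/DESIGN-T42-ADDENDUM-18.md §A18.3.

## What

Let `F = ℚ_v`, `Γ = Γ_F`, `A_n = E[2^n](χ_u)|_Γ` (the tree's `twistedTorsionGaloisModule` restricted along
`absGaloisRestrict`), `C_n ⊆ A_n` `Γ`-stable lines with `ι(C_J) ⊆ C_{J'}`, `2^{J'−J} C_{J'} ⊆ C_J` onto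
(`ι = twistedTorsionIncl`, `π = twistedTorsionMulPow`, `ι ∘ π = 2^{J'−J}`), and suppose
`2^{J'−J} · H²(Γ, C_{J'}(χ_u)) = 0` (file XXXVIII with `J' − J = |u − 1|`).

* `subsingleton_cohomology_three_adicCompletion` — `H³(ℚ_v, M) = 0` for a `2`-primary discrete `M`
  (`cd_2 Γ_{ℚ_v} ≤ 2`, tree `groupCdLE_two_absoluteGaloisGroup`).
* `exists_twisted_lift` — **the lift**: for a continuous `1`-cocycle `ξ` of `Γ` in `A_J/C_J` which on a
  subgroup `G` is `ḡ + ∂d` (`g : G → A_J`), there are a continuous `1`-cocycle `t` of `Γ` in `A_{J'}(χ_u)` and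
  `a ∈ A_{J'}` with `t(τ) − ι g(τ) − (τ ⋆ a − a) ∈ C_{J'}` for all `τ ∈ G`.
  Proof (Greenberg's level-raising, LNM 1716 §4 p. 124): with the short exact sequences
  `0 → C_n → A_n → A_n/C_n → 0` (`isSES_subtype_mkQ`) and the morphism `(ι|_C, ι, ῑ)` between them,
  `δ'(ῑ_*[ξ]) = (ι|_C)_*(δ[ξ])` (`IsSES.cohomologyMap_δ₁`); `δ[ξ] = π_* y` for some `y ∈ H²(Γ, C_{J'})`
  because `H²(π)` is onto (`0 → ker π → C_{J'} →(π) C_J → 0`, `H³(Γ, ker π) = 0`,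
  `IsSES.exists_map_two_eq_of_subsingleton_three`), and `(ι|_C)_* π_* y = 2^{J'−J} y = 0`
  (`cohomologyMap_two_comp_eq_smul`, file XXXVI).  So `ῑ_*[ξ]` lifts to `[t] ∈ H¹(Γ, A_{J'}(χ_u))`
  (`IsSES.exists_map_one_eq_of_δ₁_eq_zero`), i.e. `t mod C_{J'} = ῑ ∘ ξ + ∂e`; on `G` this reads
  `t ≡ ι g + ∂a (mod C_{J'})` for a lift `a` of `ῑ d + e`.

References: [GreenbergLNM1716] §4 pp. 107, 123–125; [SerreGaloisCohomology1997] I §2.2–2.3, II §4.3 Prop. 12;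
[NeukirchSchmidtWingberg2008] (1.3.2), (1.3.3).
-/

set_option autoImplicit false
set_option linter.dupNamespace false

noncomputable section

open scoped Classical

namespace Summit.BirchSwinnertonDyer.BirchSwinnertonDyer.Theorems.MultTransportTwistedDescent

open NumberField IsDedekindDomain Field WeierstrassCurve CategoryTheory Function
  Literature.NumberTheory.GaloisRepresentations Literature.NumberTheory.EllipticCurves
  IsDedekindDomain.HeightOneSpectrum ContinuousCohomology TopRep ContRepresentation

/-! ## §1 `H³(ℚ_v, M) = 0` for `2`-primary `M` -/

/-- **`H³(ℚ_v, M) = 0`** for a discrete `2`-primary `Γ_{ℚ_v}`-module `M` (`cd_2 Γ_{ℚ_v} ≤ 2`, Serre II §4.3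
Prop. 12; tree `groupCdLE_two_absoluteGaloisGroup` for the local field `ℚ_v`).
[cite: SerreGaloisCohomology1997, II §4.3 Prop. 12] -/
theorem subsingleton_cohomology_three_adicCompletion {v : HeightOneSpectrum (𝓞 ℚ)} {M : Type}
    [AddCommGroup M] [TopologicalSpace M] [DiscreteTopology M]
    (ρ : ContinuousRep (absoluteGaloisGroup (v.adicCompletion ℚ)) ℤ M) (hM : IsPrimaryTorsion 2 M) :
    Subsingleton (continuousCohomology 3 ρ.toTopRep) := by
  haveI : CharZero (v.adicCompletion ℚ) := charZero_adicCompletion v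
  exact groupCdLE_two_absoluteGaloisGroup (v.adicCompletion ℚ) 2 M ρ hM (by norm_num)

/-! ## §2 The lift -/

variable (W : WeierstrassCurve ℚ) (κ : ZpExtension ℚ 2) {v : HeightOneSpectrum (𝓞 ℚ)}
  {J J' : ℕ} (hJJ : J ≤ J') (u : ℤ) (hu : (2 : ℤ) ∣ u - 1)
  (C : Submodule ℤ (W.geomTorsion ((2 ^ J : ℕ) : ℤ)))
  (hC : ∀ σ : absoluteGaloisGroup (v.adicCompletion ℚ), C ≤ C.comap
    (((W.twistedTorsionGaloisModule 2 κ J u hu).restrict (absGaloisRestrict ℚ (v.adicCompletion ℚ))) σ))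
  (C' : Submodule ℤ (W.geomTorsion ((2 ^ J' : ℕ) : ℤ)))
  (hC' : ∀ σ : absoluteGaloisGroup (v.adicCompletion ℚ), C' ≤ C'.comap
    (((W.twistedTorsionGaloisModule 2 κ J' u hu).restrict (absGaloisRestrict ℚ (v.adicCompletion ℚ))) σ))

set_option maxHeartbeats 400000 in
/-- **Lifting an extended quotient class to `E[2^{J'}](χ_u)`** (Greenberg's level-raising; see the module
docstring for the statement and the proof). [cite: GreenbergLNM1716, §4 pp. 107, 123–125]
[cite: SerreGaloisCohomology1997, I §2.2–2.3] [cite: NeukirchSchmidtWingberg2008, (1.3.2), (1.3.3)] -/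
theorem exists_twisted_lift
    (hCC' : ∀ T ∈ C, W.twistedTorsionIncl 2 κ hJJ u hu T ∈ C')
    (hπ : ∀ P ∈ C', W.twistedTorsionMulPow 2 κ hJJ u hu P ∈ C)
    (hπsurj : ∀ T ∈ C, ∃ P ∈ C', W.twistedTorsionMulPow 2 κ hJJ u hu P = T)
    (hkill : ∀ y : continuousCohomology 2 (((W.twistedTorsionGaloisModule 2 κ J' u hu).restrict
      (absGaloisRestrict ℚ (v.adicCompletion ℚ))).subrepresentation C' hC').toTopRep, 2 ^ (J' - J) • y = 0)
    (ξ : contOneCocycles (((W.twistedTorsionGaloisModule 2 κ J u hu).restrict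
      (absGaloisRestrict ℚ (v.adicCompletion ℚ))).quotient C hC).toTopRep)
    (G : Subgroup (absoluteGaloisGroup (v.adicCompletion ℚ)))
    (g : G → W.geomTorsion ((2 ^ J : ℕ) : ℤ)) (d : W.geomTorsion ((2 ^ J : ℕ) : ℤ) ⧸ C)
    (hξ : ∀ τ : G, ξ.1 τ = Submodule.Quotient.mk (g τ) +
      ((((W.twistedTorsionGaloisModule 2 κ J u hu).restrict
        (absGaloisRestrict ℚ (v.adicCompletion ℚ))).quotient C hC) (τ : absoluteGaloisGroup (v.adicCompletion ℚ)) d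
        - d)) :
    ∃ (t : contOneCocycles ((W.twistedTorsionGaloisModule 2 κ J' u hu).restrict
        (absGaloisRestrict ℚ (v.adicCompletion ℚ))).toTopRep) (a : W.geomTorsion ((2 ^ J' : ℕ) : ℤ)),
      ∀ τ : G, t.1 τ - W.twistedTorsionIncl 2 κ hJJ u hu (g τ) -
        (((W.twistedTorsionGaloisModule 2 κ J' u hu).restrict (absGaloisRestrict ℚ (v.adicCompletion ℚ)))
          (τ : absoluteGaloisGroup (v.adicCompletion ℚ)) a - a) ∈ C' := by
  haveI := absoluteGaloisGroup_compactSpace (v.adicCompletion ℚ)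
  -- the modules and the two short exact sequences
  set R := (W.twistedTorsionGaloisModule 2 κ J u hu).restrict (absGaloisRestrict ℚ (v.adicCompletion ℚ))
    with hR
  set R' := (W.twistedTorsionGaloisModule 2 κ J' u hu).restrict (absGaloisRestrict ℚ (v.adicCompletion ℚ))
    with hR'
  have h : IsSES (subtypeHom R C hC) (R.mkQHom C hC) := isSES_subtype_mkQ R C hC
  have h' : IsSES (subtypeHom R' C' hC') (R'.mkQHom C' hC') := isSES_subtype_mkQ R' C' hC'
  -- the level maps `ι : A_J → A_{J'}`, `π : A_{J'} → A_J` over `Γ_F`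
  let ιI := (W.twistedTorsionIncl 2 κ hJJ u hu).restrictField (v.adicCompletion ℚ)
  let πI := (W.twistedTorsionMulPow 2 κ hJJ u hu).restrictField (v.adicCompletion ℚ)
  have hιR : ∀ (σ : absoluteGaloisGroup (v.adicCompletion ℚ)) (x : W.geomTorsion ((2 ^ J : ℕ) : ℤ)),
      ιI (R σ x) = R' σ (ιI x) := fun σ x ↦ DFunLike.congr_fun (ιI.isIntertwining' σ) x
  have hπR : ∀ (σ : absoluteGaloisGroup (v.adicCompletion ℚ)) (x : W.geomTorsion ((2 ^ J' : ℕ) : ℤ)),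
      πI (R' σ x) = R σ (πI x) := fun σ x ↦ DFunLike.congr_fun (πI.isIntertwining' σ) x
  -- the morphism of short exact sequences `(φ₁, φ₂, φ₃)`
  let φ₂ : R.toTopRep ⟶ R'.toTopRep := TopRep.ofHom ⟨ιI.toContinuousLinearMap, ιI.isIntertwining'⟩
  let φ₁ : (R.subrepresentation C hC).toTopRep ⟶ (R'.subrepresentation C' hC').toTopRep :=
    TopRep.ofHom
      { toLinearMap := ιI.toContinuousLinearMap.toLinearMap.restrict (p := C) (q := C') hCC'
        cont := continuous_of_discreteTopology
        isIntertwining' := fun σ ↦ ContinuousLinearMap.ext fun c ↦ Subtype.ext (hιR σ c) }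
  have hCle : C ≤ C'.comap ιI.toContinuousLinearMap.toLinearMap := fun T hT ↦ hCC' T hT
  let φ₃ : (R.quotient C hC).toTopRep ⟶ (R'.quotient C' hC').toTopRep :=
    TopRep.ofHom
      { toLinearMap := Submodule.mapQ C C' ιI.toContinuousLinearMap.toLinearMap hCle
        cont := continuous_of_discreteTopology
        isIntertwining' := fun σ ↦ ContinuousLinearMap.ext fun x ↦ by
          induction x using Submodule.Quotient.induction_on with
          | _ m =>
            change Submodule.mapQ C C' ιI.toContinuousLinearMap.toLinearMap hCle
                ((R.quotient C hC) σ (Submodule.Quotient.mk m)) =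
              (R'.quotient C' hC') σ
                (Submodule.mapQ C C' ιI.toContinuousLinearMap.toLinearMap hCle (Submodule.Quotient.mk m))
            rw [ContinuousRep.quotient_apply_mk, Submodule.mapQ_apply, Submodule.mapQ_apply,
              ContinuousRep.quotient_apply_mk]
            exact congrArg _ (hιR σ m) }
  have hsq₁ : ∀ x, φ₂.hom ((subtypeHom R C hC).hom x) = (subtypeHom R' C' hC').hom (φ₁.hom x) :=
    fun _ ↦ rfl
  have hsq₂ : ∀ y, φ₃.hom ((R.mkQHom C hC).hom y) = (R'.mkQHom C' hC').hom (φ₂.hom y) := fun _ ↦ rfl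
  -- the short exact sequence `0 → ker π → C_{J'} →(π) C_J → 0` and `H³(ker π) = 0`
  let πC : (R'.subrepresentation C' hC').toTopRep ⟶ (R.subrepresentation C hC).toTopRep :=
    TopRep.ofHom
      { toLinearMap := πI.toContinuousLinearMap.toLinearMap.restrict (p := C') (q := C) hπ
        cont := continuous_of_discreteTopology
        isIntertwining' := fun σ ↦ ContinuousLinearMap.ext fun c ↦ Subtype.ext (hπR σ c) }
  let Kk : Submodule ℤ C' := LinearMap.ker (πI.toContinuousLinearMap.toLinearMap.restrict (p := C') (q := C) hπ)
  have hKk : ∀ σ, Kk ≤ Kk.comap ((R'.subrepresentation C' hC') σ) := by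
    intro σ c hc
    rw [Submodule.mem_comap, LinearMap.mem_ker]
    apply Subtype.ext
    change πI (R' σ (c : W.geomTorsion ((2 ^ J' : ℕ) : ℤ))) = 0
    rw [hπR, show πI (c : W.geomTorsion ((2 ^ J' : ℕ) : ℤ)) = 0 from congrArg Subtype.val
      (LinearMap.mem_ker.1 hc), map_zero]
  have hSESk : IsSES (subtypeHom (R'.subrepresentation C' hC') Kk hKk) πC :=
    { comp_eq_zero := by
        ext c
        have hc : (πI.toContinuousLinearMap.toLinearMap.restrict (p := C') (q := C) hπ) (c : C') = 0 :=
          LinearMap.mem_ker.1 c.2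
        first
          | exact congrArg Subtype.val hc
          | exact congrArg (fun x : C ↦ ((x : W.geomTorsion ((2 ^ J : ℕ) : ℤ)) : W.geomPoints)) hc
      injective := Subtype.val_injective
      exact_mid := fun y hy ↦ ⟨⟨y, LinearMap.mem_ker.2 hy⟩, rfl⟩
      surjective := by
        rintro ⟨T, hT⟩
        obtain ⟨P, hP, hPT⟩ := hπsurj T hT
        exact ⟨⟨P, hP⟩, Subtype.ext hPT⟩ }
  have ht' : ∀ t : W.geomTorsion ((2 ^ J' : ℕ) : ℤ), 2 ^ J' • t = 0 := fun t ↦ Subtype.ext (by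
    rw [AddSubmonoidClass.coe_nsmul, ZeroMemClass.coe_zero, ← natCast_zsmul]
    exact (mem_geomTorsion_iff W _ _).1 t.2)
  haveI : Subsingleton (continuousCohomology 3
      ((R'.subrepresentation C' hC').subrepresentation Kk hKk).toTopRep) :=
    subsingleton_cohomology_three_adicCompletion _ fun m ↦ ⟨J', Subtype.ext (Subtype.ext (by
      rw [AddSubmonoidClass.coe_nsmul, AddSubmonoidClass.coe_nsmul, ZeroMemClass.coe_zero, ZeroMemClass.coe_zero]
      exact ht' _))⟩
  -- `ι ∘ π = 2^{J'-J}` on `C_{J'}`, hence `H²(ι|_C) ∘ H²(π) = 2^{J'-J} = 0` on `H²(Γ, C_{J'})`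
  have hcomp : ∀ c : C', φ₁.hom (πC.hom c) = ((2 ^ (J' - J) : ℕ) : ℤ) • c := fun c ↦
    Subtype.ext (by
      rw [Submodule.coe_smul]
      exact W.twistedTorsionIncl_mulPow 2 κ hJJ u hu (c : W.geomTorsion ((2 ^ J' : ℕ) : ℤ)))
  have hkill0 : ∀ x : continuousCohomology 1 (R.quotient C hC).toTopRep, cohomologyMap φ₁ 2 (h.δ₁ x) = 0 := by
    intro x
    obtain ⟨y, hy⟩ := hSESk.exists_map_two_eq_of_subsingleton_three (h.δ₁ x)
    rw [← hy, cohomologyMap_two_comp_eq_smul πC φ₁ ((2 ^ (J' - J) : ℕ) : ℤ) hcomp y, Nat.cast_smul_eq_nsmul]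
    exact hkill y
  -- the lift of `ῑ_*[ξ]`
  have hδ' : h'.δ₁ (cohomologyMap φ₃ 1 (oneCocycleClass _ ξ)) = 0 :=
    (IsSES.cohomologyMap_δ₁ h h' hsq₁ hsq₂ (oneCocycleClass _ ξ)).symm.trans (hkill0 _)
  obtain ⟨z, hz⟩ := h'.exists_map_one_eq_of_δ₁_eq_zero _ hδ'
  obtain ⟨t, rfl⟩ := oneCocycleClass_surjective _ z
  rw [cohomologyMap_oneCocycleClass, cohomologyMap_oneCocycleClass] at hz
  have h0 : oneCocycleClass _ (contOneCocycles.pullback (ContinuousMonoidHom.id _) (resIdHom (R'.mkQHom C' hC')) t -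
      contOneCocycles.pullback (ContinuousMonoidHom.id _) (resIdHom φ₃) ξ) = 0 := by
    rw [oneCocycleClass_sub, sub_eq_zero]
    exact hz
  obtain ⟨e, he⟩ := (oneCocycleClass_eq_zero_iff _ _).1 h0
  -- a lift `a` of `ῑ d + e`
  obtain ⟨a, ha⟩ := Submodule.Quotient.mk_surjective C' (φ₃.hom d + e)
  refine ⟨t, a, fun τ ↦ ?_⟩
  have h1 := he (τ : absoluteGaloisGroup (v.adicCompletion ℚ))
  rw [Submodule.coe_sub, ContinuousMap.sub_apply, pullback_id_resIdHom_apply, pullback_id_resIdHom_apply, hξ,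
    map_add, map_sub] at h1
  -- `h1 : mk (t τ) - (mk (ι g τ) + (φ₃ (D τ d) - φ₃ d)) = D' τ e - e`
  have h2 : φ₃.hom ((R.quotient C hC) (τ : absoluteGaloisGroup (v.adicCompletion ℚ)) d) =
      (R'.quotient C' hC') (τ : absoluteGaloisGroup (v.adicCompletion ℚ)) (φ₃.hom d) :=
    ContinuousRep.hom_comm_apply φ₃ (τ : absoluteGaloisGroup (v.adicCompletion ℚ)) d
  have h3 : φ₃.hom (Submodule.Quotient.mk (g τ)) =
      Submodule.Quotient.mk (p := C') (W.twistedTorsionIncl 2 κ hJJ u hu (g τ)) := rfl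
  have h4 : (R'.mkQHom C' hC').hom (t.1 τ) = Submodule.Quotient.mk (t.1 τ) := rfl
  have h5 : (R'.quotient C' hC').toTopRep.ρ (τ : absoluteGaloisGroup (v.adicCompletion ℚ)) e =
      (R'.quotient C' hC') (τ : absoluteGaloisGroup (v.adicCompletion ℚ)) e := rfl
  rw [h2, h3, h4, h5, sub_eq_iff_eq_add] at h1
  rw [← Submodule.Quotient.eq C', Submodule.Quotient.mk_sub, Submodule.Quotient.mk_sub,
    ← ContinuousRep.quotient_apply_mk R' C' hC', ha, map_add, h1]
  abel

end Summit.BirchSwinnertonDyer.BirchSwinnertonDyer.Theorems.MultTransportTwistedDescent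

end
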